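import Mathlib
import Summits.Ventures.PercRepro2.CoinChainXAGeneralGateCells
import Summits.Ventures.PercRepro2.CoinChainXAStarFacts
import Summits.Ventures.PercRepro2.CoinChainXAGateHullGen

/-!
# (XA′) FOR EVERY ADMISSIBLE GATE ON THE SIX-CELL SUB-CASE, ARBITRARY COIN-ENTERED SET
(blind cell PercRepro2, night-2 g28; proofs/NIGHT2-DARC.md §69)

`chain_XA'_six_general_gate`: for `ent = {m}`, ANY `ent' ∋ j`, entry markers `x = 1[m ∈ ·]`, `y = 1[j ∈ ·]` and
ANY gate `d'` satisfying the standing hypotheses (nonnegative, `d' ≤ d`, log-supermodular, cross-log-supermodular with `d`),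
the cleared (XA′) `Cross ≤ a0·U001` holds — the hypothesis `hXA'` of `chain_functional_nonneg_of_XA'`.  The proof: the
thirteen moment identities (`sixg_*`), the five gate facts (`gate_fact_H2` … `H5`, Fact 1 of `sixg_fact1`), the facts of
the closed / top / `1[j ∈ W]` gate certificates and of the (★) certificate (`star_fact*`), and the cell-level theorem
`xa_general_gate_cells` (the bilinear corner argument).  `chain_functional_nonneg_six_general_gate`: the AND-switch chain
at every `ρ ∈ [0, 1]` with that gate.  This closes the six-cell sub-case of the mixed regime of (XA′) for every gate.
-/

namespace Summit.Ventures.PercRepro2.Coin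

open Classical

section GeneralGate

variable {V : Type*} [DecidableEq V] {R : Type*} [Field R] [LinearOrder R] [IsStrictOrderedRing R]

/-- Pointwise Holley inequality for the law pair `(νd, νd')`. -/
lemma six_pw_dw (U : Finset V) (ν d d' : Finset V → R) (hν0 : ∀ W, 0 ≤ ν W)
    (hν : ∀ s ⊆ U, ∀ t ⊆ U, ν s * ν t ≤ ν (s ∩ t) * ν (s ∪ t)) (hd0 : ∀ W, 0 ≤ d W) (hd'0 : ∀ W, 0 ≤ d' W)
    (hdd' : ∀ s t, d s * d' t ≤ d (s ∩ t) * d' (s ∪ t)) (s : Finset V) (hs : s ⊆ U) (t : Finset V) (ht : t ⊆ U) :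
    ν s * d s * (ν t * d' t) ≤ ν (s ∩ t) * d (s ∩ t) * (ν (s ∪ t) * d' (s ∪ t)) := by
  calc ν s * d s * (ν t * d' t) = (ν s * ν t) * (d s * d' t) := by ring
    _ ≤ (ν (s ∩ t) * ν (s ∪ t)) * (d (s ∩ t) * d' (s ∪ t)) :=
        mul_le_mul (hν s hs t ht) (hdd' s t) (mul_nonneg (hd0 _) (hd'0 _)) (mul_nonneg (hν0 _) (hν0 _))
    _ = _ := by ring

/-- Pointwise Holley inequality for the law pair `(νd', νd')`. -/
lemma six_pw_ww (U : Finset V) (ν d' : Finset V → R) (hν0 : ∀ W, 0 ≤ ν W)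
    (hν : ∀ s ⊆ U, ∀ t ⊆ U, ν s * ν t ≤ ν (s ∩ t) * ν (s ∪ t)) (hd'0 : ∀ W, 0 ≤ d' W)
    (hd'd' : ∀ s t, d' s * d' t ≤ d' (s ∩ t) * d' (s ∪ t)) (s : Finset V) (hs : s ⊆ U) (t : Finset V) (ht : t ⊆ U) :
    ν s * d' s * (ν t * d' t) ≤ ν (s ∩ t) * d' (s ∩ t) * (ν (s ∪ t) * d' (s ∪ t)) := by
  calc ν s * d' s * (ν t * d' t) = (ν s * ν t) * (d' s * d' t) := by ring
    _ ≤ (ν (s ∩ t) * ν (s ∪ t)) * (d' (s ∩ t) * d' (s ∪ t)) :=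
        mul_le_mul (hν s hs t ht) (hd'd' s t) (mul_nonneg (hd'0 _) (hd'0 _)) (mul_nonneg (hν0 _) (hν0 _))
    _ = _ := by ring

/-- Gate fact H2: `r₁u·a₁w ≤ a₁u·r₁w` — the relative openness of the gate on `D′₁` is at most that on `D*₁`. -/
lemma gate_fact_H2 (U : Finset V) (m j : V) (ent' : Finset V) (_hj : j ∈ ent')
    (ν d d' : Finset V → R)
    (hν0 : ∀ W, 0 ≤ ν W) (hν : ∀ s ⊆ U, ∀ t ⊆ U, ν s * ν t ≤ ν (s ∩ t) * ν (s ∪ t))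
    (hd0 : ∀ W, 0 ≤ d W) (hd'0 : ∀ W, 0 ≤ d' W)
    (hdd' : ∀ s t, d s * d' t ≤ d (s ∩ t) * d' (s ∪ t)) :
    (∑ W ∈ U.powerset.filter (fun W => m ∈ W ∧ j ∈ W), ν W * d W) * (∑ W ∈ U.powerset.filter (fun W => m ∉ W ∧ j ∈ W), ν W * d' W) ≤ (∑ W ∈ U.powerset.filter (fun W => m ∉ W ∧ j ∈ W), ν W * d W) * (∑ W ∈ U.powerset.filter (fun W => m ∈ W ∧ j ∈ W), ν W * d' W) := by
  have h := ad_sets_dec U (fun W => ν W * d W) (fun W => ν W * d' W) (fun W => ν W * d W) (fun W => ν W * d' W)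
    (fun W => mul_nonneg (hν0 W) (hd0 W)) (fun W => mul_nonneg (hν0 W) (hd'0 W)) (fun W => mul_nonneg (hν0 W) (hd0 W)) (fun W => mul_nonneg (hν0 W) (hd'0 W))
    (fun W => (m ∈ W ∧ j ∈ W)) (fun W => (m ∉ W ∧ j ∈ W)) (fun W => (m ∉ W ∧ j ∈ W)) (fun W => (m ∈ W ∧ j ∈ W))
    (fun s hs t ht hA hB => by
      exact ⟨⟨(fun hh => hB.1 (Finset.mem_inter.1 hh).2), (Finset.mem_inter.2 ⟨hA.2, hB.2⟩)⟩, ⟨(Finset.mem_union_left _ hA.1), (Finset.mem_union_left _ hA.2)⟩, six_pw_dw U ν d d' hν0 hν hd0 hd'0 hdd' s hs t ht⟩)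
  exact h

/-- Gate fact H3: `r₁u·(b_w + r₀w) ≤ (b_u + r₀u)·r₁w`. -/
lemma gate_fact_H3 (U : Finset V) (m j : V) (ent' : Finset V) (_hj : j ∈ ent')
    (ν d d' : Finset V → R)
    (hν0 : ∀ W, 0 ≤ ν W) (hν : ∀ s ⊆ U, ∀ t ⊆ U, ν s * ν t ≤ ν (s ∩ t) * ν (s ∪ t))
    (hd0 : ∀ W, 0 ≤ d W) (hd'0 : ∀ W, 0 ≤ d' W)
    (hdd' : ∀ s t, d s * d' t ≤ d (s ∩ t) * d' (s ∪ t)) :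
    (∑ W ∈ U.powerset.filter (fun W => m ∈ W ∧ j ∈ W), ν W * d W) * ((∑ W ∈ U.powerset.filter (fun W => m ∈ W ∧ ¬ ∃ r ∈ ent', r ∈ W), ν W * d' W) + ((∑ W ∈ U.powerset.filter (fun W => m ∈ W ∧ j ∉ W ∧ ∃ r ∈ ent', r ∈ W), ν W * d' W))) ≤ ((∑ W ∈ U.powerset.filter (fun W => m ∈ W ∧ ¬ ∃ r ∈ ent', r ∈ W), ν W * d W) + ((∑ W ∈ U.powerset.filter (fun W => m ∈ W ∧ j ∉ W ∧ ∃ r ∈ ent', r ∈ W), ν W * d W))) * (∑ W ∈ U.powerset.filter (fun W => m ∈ W ∧ j ∈ W), ν W * d' W) := by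
  have h := ad_sets_dec U (fun W => ν W * d W) (fun W => ν W * d' W) (fun W => ν W * d W) (fun W => ν W * d' W)
    (fun W => mul_nonneg (hν0 W) (hd0 W)) (fun W => mul_nonneg (hν0 W) (hd'0 W)) (fun W => mul_nonneg (hν0 W) (hd0 W)) (fun W => mul_nonneg (hν0 W) (hd'0 W))
    (fun W => (m ∈ W ∧ j ∈ W)) (fun W => (m ∈ W ∧ ¬ ∃ r ∈ ent', r ∈ W) ∨ (m ∈ W ∧ j ∉ W ∧ ∃ r ∈ ent', r ∈ W)) (fun W => (m ∈ W ∧ ¬ ∃ r ∈ ent', r ∈ W) ∨ (m ∈ W ∧ j ∉ W ∧ ∃ r ∈ ent', r ∈ W)) (fun W => (m ∈ W ∧ j ∈ W))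
    (fun s hs t ht hA hB => by
      rcases hB with hB | hB
      · exact ⟨Or.inl ⟨(Finset.mem_inter.2 ⟨hA.1, hB.1⟩), (fun ⟨r, hr, hh⟩ => hB.2 ⟨r, hr, (Finset.mem_inter.1 hh).2⟩)⟩, ⟨(Finset.mem_union_left _ hA.1), (Finset.mem_union_left _ hA.2)⟩, six_pw_dw U ν d d' hν0 hν hd0 hd'0 hdd' s hs t ht⟩
      · by_cases hEst : ∃ r ∈ ent', r ∈ s ∩ t
        · exact ⟨Or.inr (⟨(Finset.mem_inter.2 ⟨hA.1, hB.1⟩), (fun hh => hB.2.1 (Finset.mem_inter.1 hh).2), hEst⟩), ⟨(Finset.mem_union_left _ hA.1), (Finset.mem_union_left _ hA.2)⟩, six_pw_dw U ν d d' hν0 hν hd0 hd'0 hdd' s hs t ht⟩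
        · exact ⟨Or.inl ⟨(Finset.mem_inter.2 ⟨hA.1, hB.1⟩), hEst⟩, ⟨(Finset.mem_union_left _ hA.1), (Finset.mem_union_left _ hA.2)⟩, six_pw_dw U ν d d' hν0 hν hd0 hd'0 hdd' s hs t ht⟩)
  simp only [sum_filter_or U (fun W => m ∈ W ∧ ¬ ∃ r ∈ ent', r ∈ W) (fun W => (m ∈ W ∧ j ∉ W ∧ ∃ r ∈ ent', r ∈ W)) (fun W => ν W * d' W) (fun W h => (h.1.2 h.2.2.2)), sum_filter_or U (fun W => m ∈ W ∧ ¬ ∃ r ∈ ent', r ∈ W) (fun W => (m ∈ W ∧ j ∉ W ∧ ∃ r ∈ ent', r ∈ W)) (fun W => ν W * d W) (fun W h => (h.1.2 h.2.2.2))] at h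
  exact h

/-- Gate fact H4: `a₀u·o_w ≤ o_u·a₀w` — the hidden gate mass on the ideal is bounded by that on `D′₀`. -/
lemma gate_fact_H4 (U : Finset V) (m j : V) (ent' : Finset V) (hj : j ∈ ent')
    (ν d d' : Finset V → R)
    (hν0 : ∀ W, 0 ≤ ν W) (hν : ∀ s ⊆ U, ∀ t ⊆ U, ν s * ν t ≤ ν (s ∩ t) * ν (s ∪ t))
    (hd0 : ∀ W, 0 ≤ d W) (hd'0 : ∀ W, 0 ≤ d' W)
    (hdd' : ∀ s t, d s * d' t ≤ d (s ∩ t) * d' (s ∪ t)) :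
    (∑ W ∈ U.powerset.filter (fun W => m ∉ W ∧ j ∉ W ∧ ∃ r ∈ ent', r ∈ W), ν W * d W) * (∑ W ∈ U.powerset.filter (fun W => m ∉ W ∧ ¬ ∃ r ∈ ent', r ∈ W), ν W * d' W) ≤ (∑ W ∈ U.powerset.filter (fun W => m ∉ W ∧ ¬ ∃ r ∈ ent', r ∈ W), ν W * d W) * (∑ W ∈ U.powerset.filter (fun W => m ∉ W ∧ j ∉ W ∧ ∃ r ∈ ent', r ∈ W), ν W * d' W) := by
  have h := ad_sets_dec U (fun W => ν W * d W) (fun W => ν W * d' W) (fun W => ν W * d W) (fun W => ν W * d' W)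
    (fun W => mul_nonneg (hν0 W) (hd0 W)) (fun W => mul_nonneg (hν0 W) (hd'0 W)) (fun W => mul_nonneg (hν0 W) (hd0 W)) (fun W => mul_nonneg (hν0 W) (hd'0 W))
    (fun W => (m ∉ W ∧ j ∉ W ∧ ∃ r ∈ ent', r ∈ W)) (fun W => (m ∉ W ∧ ¬ ∃ r ∈ ent', r ∈ W)) (fun W => (m ∉ W ∧ ¬ ∃ r ∈ ent', r ∈ W)) (fun W => (m ∉ W ∧ j ∉ W ∧ ∃ r ∈ ent', r ∈ W))
    (fun s hs t ht hA hB => by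
      exact ⟨⟨(fun hh => hA.1 (Finset.mem_inter.1 hh).1), (fun ⟨r, hr, hh⟩ => hB.2 ⟨r, hr, (Finset.mem_inter.1 hh).2⟩)⟩, ⟨(fun hh => (Finset.mem_union.1 hh).elim hA.1 hB.1), (fun hh => (Finset.mem_union.1 hh).elim hA.2.1 (fun hh => hB.2 ⟨j, hj, hh⟩)), (let ⟨r, hr, hh⟩ := hA.2.2; ⟨r, hr, Finset.mem_union_left _ hh⟩)⟩, six_pw_dw U ν d d' hν0 hν hd0 hd'0 hdd' s hs t ht⟩)
  exact h

/-- Gate fact H5: the gate's own log-supermodularity at the set level, `a₁w·(b_w + r₀w) ≤ (o_w + a₀w)·r₁w`. -/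
lemma gate_fact_H5 (U : Finset V) (m j : V) (ent' : Finset V) (_hj : j ∈ ent')
    (ν d' : Finset V → R)
    (hν0 : ∀ W, 0 ≤ ν W) (hν : ∀ s ⊆ U, ∀ t ⊆ U, ν s * ν t ≤ ν (s ∩ t) * ν (s ∪ t))
    (hd'0 : ∀ W, 0 ≤ d' W)
    (hd'd' : ∀ s t, d' s * d' t ≤ d' (s ∩ t) * d' (s ∪ t)) :
    (∑ W ∈ U.powerset.filter (fun W => m ∉ W ∧ j ∈ W), ν W * d' W) * ((∑ W ∈ U.powerset.filter (fun W => m ∈ W ∧ ¬ ∃ r ∈ ent', r ∈ W), ν W * d' W) + ((∑ W ∈ U.powerset.filter (fun W => m ∈ W ∧ j ∉ W ∧ ∃ r ∈ ent', r ∈ W), ν W * d' W))) ≤ ((∑ W ∈ U.powerset.filter (fun W => m ∉ W ∧ ¬ ∃ r ∈ ent', r ∈ W), ν W * d' W) + ((∑ W ∈ U.powerset.filter (fun W => m ∉ W ∧ j ∉ W ∧ ∃ r ∈ ent', r ∈ W), ν W * d' W))) * (∑ W ∈ U.powerset.filter (fun W => m ∈ W ∧ j ∈ W), ν W * d' W)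 := by
  have h := ad_sets_dec U (fun W => ν W * d' W) (fun W => ν W * d' W) (fun W => ν W * d' W) (fun W => ν W * d' W)
    (fun W => mul_nonneg (hν0 W) (hd'0 W)) (fun W => mul_nonneg (hν0 W) (hd'0 W)) (fun W => mul_nonneg (hν0 W) (hd'0 W)) (fun W => mul_nonneg (hν0 W) (hd'0 W))
    (fun W => (m ∉ W ∧ j ∈ W)) (fun W => (m ∈ W ∧ ¬ ∃ r ∈ ent', r ∈ W) ∨ (m ∈ W ∧ j ∉ W ∧ ∃ r ∈ ent', r ∈ W)) (fun W => (m ∉ W ∧ ¬ ∃ r ∈ ent', r ∈ W) ∨ (m ∉ W ∧ j ∉ W ∧ ∃ r ∈ ent', r ∈ W)) (fun W => (m ∈ W ∧ j ∈ W))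
    (fun s hs t ht hA hB => by
      rcases hB with hB | hB
      · exact ⟨Or.inl ⟨(fun hh => hA.1 (Finset.mem_inter.1 hh).1), (fun ⟨r, hr, hh⟩ => hB.2 ⟨r, hr, (Finset.mem_inter.1 hh).2⟩)⟩, ⟨(Finset.mem_union_right _ hB.1), (Finset.mem_union_left _ hA.2)⟩, six_pw_ww U ν d' hν0 hν hd'0 hd'd' s hs t ht⟩
      · by_cases hEst : ∃ r ∈ ent', r ∈ s ∩ t
        · exact ⟨Or.inr (⟨(fun hh => hA.1 (Finset.mem_inter.1 hh).1), (fun hh => hB.2.1 (Finset.mem_inter.1 hh).2), hEst⟩), ⟨(Finset.mem_union_right _ hB.1), (Finset.mem_union_left _ hA.2)⟩, six_pw_ww U ν d' hν0 hν hd'0 hd'd' s hs t ht⟩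
        · exact ⟨Or.inl ⟨(fun hh => hA.1 (Finset.mem_inter.1 hh).1), hEst⟩, ⟨(Finset.mem_union_right _ hB.1), (Finset.mem_union_left _ hA.2)⟩, six_pw_ww U ν d' hν0 hν hd'0 hd'd' s hs t ht⟩)
  simp only [sum_filter_or U (fun W => m ∈ W ∧ ¬ ∃ r ∈ ent', r ∈ W) (fun W => (m ∈ W ∧ j ∉ W ∧ ∃ r ∈ ent', r ∈ W)) (fun W => ν W * d' W) (fun W h => (h.1.2 h.2.2.2)), sum_filter_or U (fun W => m ∉ W ∧ ¬ ∃ r ∈ ent', r ∈ W) (fun W => (m ∉ W ∧ j ∉ W ∧ ∃ r ∈ ent', r ∈ W)) (fun W => ν W * d' W) (fun W h => (h.1.2 h.2.2.2))] at h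
  exact h

/-- FACT 2 on the generic cells: `a₀u·(b + r₀) ≤ (o + a₀)·r₀u`. -/
lemma sixg_fact2_cd (U : Finset V) (m j : V) (ent' : Finset V) (hj : j ∈ ent')
    (ν c d : Finset V → R)
    (hν0 : ∀ W, 0 ≤ ν W) (hν : ∀ s ⊆ U, ∀ t ⊆ U, ν s * ν t ≤ ν (s ∩ t) * ν (s ∪ t))
    (hc0 : ∀ W, 0 ≤ c W) (hd0 : ∀ W, 0 ≤ d W)
    (hcc : ∀ s t, c s * c t ≤ c (s ∩ t) * c (s ∪ t))
    (hdd : ∀ s t, d s * d t ≤ d (s ∩ t) * d (s ∪ t))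
    (hcd : ∀ s t, c s * d t ≤ c (s ∩ t) * d (s ∪ t)) :
    (∑ W ∈ U.powerset.filter (fun W => m ∉ W ∧ j ∉ W ∧ ∃ r ∈ ent', r ∈ W), ν W * d W) * ((∑ W ∈ U.powerset.filter (fun W => m ∈ W ∧ ¬ ∃ r ∈ ent', r ∈ W), ν W * c W) + ((∑ W ∈ U.powerset.filter (fun W => m ∈ W ∧ j ∉ W ∧ ∃ r ∈ ent', r ∈ W), ν W * c W))) ≤ ((∑ W ∈ U.powerset.filter (fun W => m ∉ W ∧ ¬ ∃ r ∈ ent', r ∈ W), ν W * c W) + ((∑ W ∈ U.powerset.filter (fun W => m ∉ W ∧ j ∉ W ∧ ∃ r ∈ ent', r ∈ W), ν W * c W))) * (∑ W ∈ U.powerset.filter (fun W => m ∈ W ∧ j ∉ W ∧ ∃ r ∈ ent', r ∈ W), ν W * d W) := by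
  have h := ad_sets_dec U (fun W => ν W * d W) (fun W => ν W * c W) (fun W => ν W * c W) (fun W => ν W * d W)
    (fun W => mul_nonneg (hν0 W) (hd0 W)) (fun W => mul_nonneg (hν0 W) (hc0 W)) (fun W => mul_nonneg (hν0 W) (hc0 W)) (fun W => mul_nonneg (hν0 W) (hd0 W))
    (fun W => (m ∉ W ∧ j ∉ W ∧ ∃ r ∈ ent', r ∈ W)) (fun W => (m ∈ W ∧ ¬ ∃ r ∈ ent', r ∈ W) ∨ (m ∈ W ∧ j ∉ W ∧ ∃ r ∈ ent', r ∈ W)) (fun W => (m ∉ W ∧ ¬ ∃ r ∈ ent', r ∈ W) ∨ (m ∉ W ∧ j ∉ W ∧ ∃ r ∈ ent', r ∈ W)) (fun W => (m ∈ W ∧ j ∉ W ∧ ∃ r ∈ ent', r ∈ W))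
    (fun s hs t ht hA hB => by
      rcases hB with hB | hB
      · exact ⟨Or.inl ⟨(fun hh => hA.1 (Finset.mem_inter.1 hh).1), (fun ⟨r, hr, hh⟩ => hB.2 ⟨r, hr, (Finset.mem_inter.1 hh).2⟩)⟩, ⟨(Finset.mem_union_right _ hB.1), (fun hh => (Finset.mem_union.1 hh).elim hA.2.1 (fun hh => hB.2 ⟨j, hj, hh⟩)), (let ⟨r, hr, hh⟩ := hA.2.2; ⟨r, hr, Finset.mem_union_left _ hh⟩)⟩, six_pw_dc U ν c d hν0 hν hc0 hd0 hcc hdd hcd s hs t ht⟩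
      · by_cases hEst : ∃ r ∈ ent', r ∈ s ∩ t
        · exact ⟨Or.inr (⟨(fun hh => hA.1 (Finset.mem_inter.1 hh).1), (fun hh => hA.2.1 (Finset.mem_inter.1 hh).1), hEst⟩), ⟨(Finset.mem_union_right _ hB.1), (fun hh => (Finset.mem_union.1 hh).elim hA.2.1 hB.2.1), (let ⟨r, hr, hh⟩ := hA.2.2; ⟨r, hr, Finset.mem_union_left _ hh⟩)⟩, six_pw_dc U ν c d hν0 hν hc0 hd0 hcc hdd hcd s hs t ht⟩
        · exact ⟨Or.inl ⟨(fun hh => hA.1 (Finset.mem_inter.1 hh).1), hEst⟩, ⟨(Finset.mem_union_right _ hB.1), (fun hh => (Finset.mem_union.1 hh).elim hA.2.1 hB.2.1), (let ⟨r, hr, hh⟩ := hA.2.2; ⟨r, hr, Finset.mem_union_left _ hh⟩)⟩, six_pw_dc U ν c d hν0 hν hc0 hd0 hcc hdd hcd s hs t ht⟩)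
  simp only [sum_filter_or U (fun W => m ∈ W ∧ ¬ ∃ r ∈ ent', r ∈ W) (fun W => (m ∈ W ∧ j ∉ W ∧ ∃ r ∈ ent', r ∈ W)) (fun W => ν W * c W) (fun W h => (h.1.2 h.2.2.2)), sum_filter_or U (fun W => m ∉ W ∧ ¬ ∃ r ∈ ent', r ∈ W) (fun W => (m ∉ W ∧ j ∉ W ∧ ∃ r ∈ ent', r ∈ W)) (fun W => ν W * c W) (fun W h => (h.1.2 h.2.2.2))] at h
  exact h

set_option maxHeartbeats 1600000 in
/-- **(XA′) FOR EVERY ADMISSIBLE GATE ON THE SIX-CELL SUB-CASE** (`ent = {m}`, any `ent' ∋ j`, entry markers):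
the hypothesis `hXA'` of `chain_functional_nonneg_of_XA'`. -/
theorem chain_XA'_six_general_gate (U : Finset V) (m j : V) (ent' : Finset V) (hj : j ∈ ent') (ν c d d' : Finset V → R)
    (hν0 : ∀ W, 0 ≤ ν W) (hν : ∀ s ⊆ U, ∀ t ⊆ U, ν s * ν t ≤ ν (s ∩ t) * ν (s ∪ t))
    (hc0 : ∀ W, 0 ≤ c W) (hd0 : ∀ W, 0 ≤ d W) (hd'0 : ∀ W, 0 ≤ d' W) (hdc : ∀ W, d W ≤ c W) (hd'd : ∀ W, d' W ≤ d W)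
    (hcc : ∀ s t, c s * c t ≤ c (s ∩ t) * c (s ∪ t))
    (hdd : ∀ s t, d s * d t ≤ d (s ∩ t) * d (s ∪ t))
    (hd'd' : ∀ s t, d' s * d' t ≤ d' (s ∩ t) * d' (s ∪ t))
    (hcd : ∀ s t, c s * d t ≤ c (s ∩ t) * d (s ∪ t))
    (hdd' : ∀ s t, d s * d' t ≤ d (s ∩ t) * d' (s ∪ t))
    (x y : Finset V → R) (hx : ∀ W, x W = if m ∈ W then 1 else 0)
    (hy : ∀ W, y W = if j ∈ W then 1 else 0) :
    (((∑ W ∈ U.powerset, ν W * chainMix {m} ent' 0 c d W) * (∑ W ∈ U.powerset, ν W * chainMix {m} ent' 1 c d W * x W) - (∑ W ∈ U.powerset, ν W * chainMix {m} ent' 0 c d W * x W) * (∑ W ∈ U.powerset, ν W * chainMix {m} ent' 1 c d W)) *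
          ((∑ W ∈ U.powerset, ν W * chainMix {m} ent' 0 c d W) * (∑ W ∈ U.powerset, ν W * chainMix {m} ent' 0 c d' W * y W) - (∑ W ∈ U.powerset, ν W * chainMix {m} ent' 0 c d W * y W) * (∑ W ∈ U.powerset, ν W * chainMix {m} ent' 0 c d' W))
        + ((∑ W ∈ U.powerset, ν W * chainMix {m} ent' 0 c d W) * (∑ W ∈ U.powerset, ν W * chainMix {m} ent' 1 c d W * y W) - (∑ W ∈ U.powerset, ν W * chainMix {m} ent' 0 c d W * y W) * (∑ W ∈ U.powerset, ν W * chainMix {m} ent' 1 c d W)) *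
          ((∑ W ∈ U.powerset, ν W * chainMix {m} ent' 0 c d W) * (∑ W ∈ U.powerset, ν W * chainMix {m} ent' 0 c d' W * x W) - (∑ W ∈ U.powerset, ν W * chainMix {m} ent' 0 c d W * x W) * (∑ W ∈ U.powerset, ν W * chainMix {m} ent' 0 c d' W))) ≤
        (∑ W ∈ U.powerset, ν W * chainMix {m} ent' 0 c d W) * ((∑ W ∈ U.powerset, ν W * chainMix {m} ent' 0 c d W) * (∑ W ∈ U.powerset, ν W * chainMix {m} ent' 0 c d W) * (∑ W ∈ U.powerset, ν W * chainMix {m} ent' 1 c d' W * (x W * y W))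
          - (∑ W ∈ U.powerset, ν W * chainMix {m} ent' 0 c d W) * (∑ W ∈ U.powerset, ν W * chainMix {m} ent' 0 c d W * y W) * (∑ W ∈ U.powerset, ν W * chainMix {m} ent' 1 c d' W * x W)
          - (∑ W ∈ U.powerset, ν W * chainMix {m} ent' 0 c d W) * (∑ W ∈ U.powerset, ν W * chainMix {m} ent' 0 c d W * x W) * (∑ W ∈ U.powerset, ν W * chainMix {m} ent' 1 c d' W * y W)
          + (∑ W ∈ U.powerset, ν W * chainMix {m} ent' 0 c d W * x W) * (∑ W ∈ U.powerset, ν W * chainMix {m} ent' 0 c d W * y W) * (∑ W ∈ U.powerset, ν W * chainMix {m} ent' 1 c d' W)) := by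
  rw [sixg_a0 U m j ent' ν c d hj, sixg_a1 U m j ent' ν c d hj x hx, sixg_a2 U m j ent' ν c d hj y hy,
    sixg_b0 U m j ent' ν c d hj, sixg_b1 U m j ent' ν c d hj x hx, sixg_b2 U m j ent' ν c d hj y hy,
    sixg_e0 U m j ent' ν c d' hj, sixg_e1 U m j ent' ν c d' hj x hx, sixg_e2 U m j ent' ν c d' hj y hy,
    sixg_g0 U m j ent' ν c d' hj, sixg_g1 U m j ent' ν c d' hj x hx, sixg_g2 U m j ent' ν c d' hj y hy,
    sixg_g12 U m j ent' ν c d' hj x hx y hy]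
  exact xa_general_gate_cells _ _ _ _ _ _ _ _ _ _ _ _ _ _ _ _ _ _
    (cell_nonneg U ν c hν0 hc0 (fun W => m ∉ W ∧ ¬ ∃ r ∈ ent', r ∈ W))
    (cell_nonneg U ν c hν0 hc0 (fun W => m ∉ W ∧ j ∉ W ∧ ∃ r ∈ ent', r ∈ W))
    (cell_nonneg U ν c hν0 hc0 (fun W => m ∉ W ∧ j ∈ W))
    (cell_nonneg U ν c hν0 hc0 (fun W => m ∈ W ∧ ¬ ∃ r ∈ ent', r ∈ W))
    (cell_nonneg U ν c hν0 hc0 (fun W => m ∈ W ∧ j ∉ W ∧ ∃ r ∈ ent', r ∈ W))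
    (cell_nonneg U ν c hν0 hc0 (fun W => m ∈ W ∧ j ∈ W))
    (cell_nonneg U ν d hν0 hd0 (fun W => m ∉ W ∧ ¬ ∃ r ∈ ent', r ∈ W))
    (cell_nonneg U ν d hν0 hd0 (fun W => m ∉ W ∧ j ∉ W ∧ ∃ r ∈ ent', r ∈ W))
    (cell_nonneg U ν d hν0 hd0 (fun W => m ∉ W ∧ j ∈ W))
    (cell_nonneg U ν d hν0 hd0 (fun W => m ∈ W ∧ ¬ ∃ r ∈ ent', r ∈ W))
    (cell_nonneg U ν d hν0 hd0 (fun W => m ∈ W ∧ j ∉ W ∧ ∃ r ∈ ent', r ∈ W))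
    (cell_nonneg U ν d hν0 hd0 (fun W => m ∈ W ∧ j ∈ W))
    (cell_nonneg U ν d' hν0 hd'0 (fun W => m ∉ W ∧ ¬ ∃ r ∈ ent', r ∈ W))
    (cell_nonneg U ν d' hν0 hd'0 (fun W => m ∉ W ∧ j ∉ W ∧ ∃ r ∈ ent', r ∈ W))
    (cell_nonneg U ν d' hν0 hd'0 (fun W => m ∉ W ∧ j ∈ W))
    (cell_nonneg U ν d' hν0 hd'0 (fun W => m ∈ W ∧ ¬ ∃ r ∈ ent', r ∈ W))
    (cell_nonneg U ν d' hν0 hd'0 (fun W => m ∈ W ∧ j ∉ W ∧ ∃ r ∈ ent', r ∈ W))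
    (cell_nonneg U ν d' hν0 hd'0 (fun W => m ∈ W ∧ j ∈ W))
    (Finset.sum_le_sum (fun W _ => mul_le_mul_of_nonneg_left (hdc W) (hν0 W)) : (∑ W ∈ U.powerset.filter (fun W => m ∉ W ∧ ¬ ∃ r ∈ ent', r ∈ W), ν W * d W) ≤ (∑ W ∈ U.powerset.filter (fun W => m ∉ W ∧ ¬ ∃ r ∈ ent', r ∈ W), ν W * c W))
    (Finset.sum_le_sum (fun W _ => mul_le_mul_of_nonneg_left (hdc W) (hν0 W)) : (∑ W ∈ U.powerset.filter (fun W => m ∉ W ∧ j ∉ W ∧ ∃ r ∈ ent', r ∈ W), ν W * d W) ≤ (∑ W ∈ U.powerset.filter (fun W => m ∉ W ∧ j ∉ W ∧ ∃ r ∈ ent', r ∈ W), ν W * c W))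
    (Finset.sum_le_sum (fun W _ => mul_le_mul_of_nonneg_left (hdc W) (hν0 W)) : (∑ W ∈ U.powerset.filter (fun W => m ∉ W ∧ j ∈ W), ν W * d W) ≤ (∑ W ∈ U.powerset.filter (fun W => m ∉ W ∧ j ∈ W), ν W * c W))
    (Finset.sum_le_sum (fun W _ => mul_le_mul_of_nonneg_left (hdc W) (hν0 W)) : (∑ W ∈ U.powerset.filter (fun W => m ∈ W ∧ ¬ ∃ r ∈ ent', r ∈ W), ν W * d W) ≤ (∑ W ∈ U.powerset.filter (fun W => m ∈ W ∧ ¬ ∃ r ∈ ent', r ∈ W), ν W * c W))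
    (Finset.sum_le_sum (fun W _ => mul_le_mul_of_nonneg_left (hdc W) (hν0 W)) : (∑ W ∈ U.powerset.filter (fun W => m ∈ W ∧ j ∉ W ∧ ∃ r ∈ ent', r ∈ W), ν W * d W) ≤ (∑ W ∈ U.powerset.filter (fun W => m ∈ W ∧ j ∉ W ∧ ∃ r ∈ ent', r ∈ W), ν W * c W))
    (Finset.sum_le_sum (fun W _ => mul_le_mul_of_nonneg_left (hdc W) (hν0 W)) : (∑ W ∈ U.powerset.filter (fun W => m ∈ W ∧ j ∈ W), ν W * d W) ≤ (∑ W ∈ U.powerset.filter (fun W => m ∈ W ∧ j ∈ W), ν W * c W))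
    (Finset.sum_le_sum (fun W _ => mul_le_mul_of_nonneg_left (hd'd W) (hν0 W)) : (∑ W ∈ U.powerset.filter (fun W => m ∉ W ∧ ¬ ∃ r ∈ ent', r ∈ W), ν W * d' W) ≤ (∑ W ∈ U.powerset.filter (fun W => m ∉ W ∧ ¬ ∃ r ∈ ent', r ∈ W), ν W * d W))
    (Finset.sum_le_sum (fun W _ => mul_le_mul_of_nonneg_left (hd'd W) (hν0 W)) : (∑ W ∈ U.powerset.filter (fun W => m ∉ W ∧ j ∉ W ∧ ∃ r ∈ ent', r ∈ W), ν W * d' W) ≤ (∑ W ∈ U.powerset.filter (fun W => m ∉ W ∧ j ∉ W ∧ ∃ r ∈ ent', r ∈ W), ν W * d W))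
    (Finset.sum_le_sum (fun W _ => mul_le_mul_of_nonneg_left (hd'd W) (hν0 W)) : (∑ W ∈ U.powerset.filter (fun W => m ∉ W ∧ j ∈ W), ν W * d' W) ≤ (∑ W ∈ U.powerset.filter (fun W => m ∉ W ∧ j ∈ W), ν W * d W))
    (Finset.sum_le_sum (fun W _ => mul_le_mul_of_nonneg_left (hd'd W) (hν0 W)) : (∑ W ∈ U.powerset.filter (fun W => m ∈ W ∧ ¬ ∃ r ∈ ent', r ∈ W), ν W * d' W) ≤ (∑ W ∈ U.powerset.filter (fun W => m ∈ W ∧ ¬ ∃ r ∈ ent', r ∈ W), ν W * d W))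
    (Finset.sum_le_sum (fun W _ => mul_le_mul_of_nonneg_left (hd'd W) (hν0 W)) : (∑ W ∈ U.powerset.filter (fun W => m ∈ W ∧ j ∉ W ∧ ∃ r ∈ ent', r ∈ W), ν W * d' W) ≤ (∑ W ∈ U.powerset.filter (fun W => m ∈ W ∧ j ∉ W ∧ ∃ r ∈ ent', r ∈ W), ν W * d W))
    (Finset.sum_le_sum (fun W _ => mul_le_mul_of_nonneg_left (hd'd W) (hν0 W)) : (∑ W ∈ U.powerset.filter (fun W => m ∈ W ∧ j ∈ W), ν W * d' W) ≤ (∑ W ∈ U.powerset.filter (fun W => m ∈ W ∧ j ∈ W), ν W * d W))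
    (gate_fact_H2 U m j ent' hj ν d d' hν0 hν hd0 hd'0 hdd')
    (gate_fact_H3 U m j ent' hj ν d d' hν0 hν hd0 hd'0 hdd')
    (gate_fact_H4 U m j ent' hj ν d d' hν0 hν hd0 hd'0 hdd')
    (gate_fact_H5 U m j ent' hj ν d' hν0 hν hd'0 hd'd')
    (sixg_fact1 U m j ent' hj ν c d hν0 hν hc0 hd0 hcd)
    (sixg_fact3 U m j ent' hj ν c d hν0 hν hc0 hd0 hcd)
    (sixg_fact2_cd U m j ent' hj ν c d hν0 hν hc0 hd0 hcc hdd hcd)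
    (six_gateJGen_fact0 U m j ent' hj ν c d hν0 hν hc0 hd0 hcc hdd hcd)
    (six_gateJGen_fact1 U m j ent' hj ν c d hν0 hν hc0 hd0 hcc hdd hcd)
    (six_gateJGen_fact2 U m j ent' hj ν c d hν0 hν hc0 hd0 hcc hdd hcd)
    (six_gateJGen_fact3 U m j ent' hj ν c d hν0 hν hc0 hd0 hcc hdd hcd)
    (six_gateJGen_fact4 U m j ent' hj ν c d hν0 hν hc0 hd0 hcc hdd hcd)
    (six_gateJGen_fact5 U m j ent' hj ν c d hν0 hν hc0 hd0 hcc hdd hcd)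
    (six_gateJGen_fact6 U m j ent' hj ν c d hν0 hν hc0 hd0 hcc hdd hcd)
    (six_gateJGen_fact7 U m j ent' hj ν c d hν0 hν hc0 hd0 hcc hdd hcd)
    (six_gateJGen_fact8 U m j ent' hj ν c d hν0 hν hc0 hd0 hcc hdd hcd)
    (six_gateJGen_fact9 U m j ent' hj ν c d hν0 hν hc0 hd0 hcc hdd hcd)
    (six_gateJGen_fact10 U m j ent' hj ν c d hν0 hν hc0 hd0 hcc hdd hcd)
    (six_gateJGen_fact11 U m j ent' hj ν c d hν0 hν hc0 hd0 hcc hdd hcd)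
    (six_gateJGen_fact12 U m j ent' hj ν c d hν0 hν hc0 hd0 hcc hdd hcd)
    (star_fact0 U m j ent' hj ν c d hν0 hν hc0 hd0 hcc hdd hcd)
    (star_fact1 U m j ent' hj ν c d hν0 hν hc0 hd0 hcc hdd hcd)
    (star_fact2 U m j ent' hj ν c d hν0 hν hc0 hd0 hcc hdd hcd)
    (star_fact3 U m j ent' hj ν c d hν0 hν hc0 hd0 hcc hdd hcd)
    (star_fact4 U m j ent' hj ν c d hν0 hν hc0 hd0 hcc hdd hcd)
    (star_fact5 U m j ent' hj ν c d hν0 hν hc0 hd0 hcc hdd hcd)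
    (star_fact6 U m j ent' hj ν c d hν0 hν hc0 hd0 hcc hdd hcd)
    (star_fact7 U m j ent' hj ν c d hν0 hν hc0 hd0 hcc hdd hcd)
    (star_fact8 U m j ent' hj ν c d hν0 hν hc0 hd0 hcc hdd hcd)
    (star_fact9 U m j ent' hj ν c d hν0 hν hc0 hd0 hcc hdd hcd)
    (star_fact10 U m j ent' hj ν c d hν0 hν hc0 hd0 hcc hdd hcd)
    (star_fact11 U m j ent' hj ν c d hν0 hν hc0 hd0 hcc hdd hcd)
    (star_fact12 U m j ent' hj ν c d hν0 hν hc0 hd0 hcc hdd hcd)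
    (star_fact13 U m j ent' hj ν c d hν0 hν hc0 hd0 hcc hdd hcd)

/-- **THE AND-SWITCH CHAIN AT EVERY ρ WITH AN ARBITRARY GATE ON THE SIX-CELL SUB-CASE**: the chain functional of
`chain_functional_nonneg_of_XA'` is nonnegative for every gate `d'` satisfying the standing gate hypotheses
(`ent = {m}`, any `ent' ∋ j`, entry markers). -/
theorem chain_functional_nonneg_six_general_gate (U : Finset V) (m j : V) (ent' : Finset V) (hj : j ∈ ent')
    (ν c d d' : Finset V → R)
    (ρ : R) (hρ0 : 0 ≤ ρ) (hρ1 : ρ ≤ 1) (hν0 : ∀ W, 0 ≤ ν W)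
    (hν : ∀ s ⊆ U, ∀ t ⊆ U, ν s * ν t ≤ ν (s ∩ t) * ν (s ∪ t))
    (hc0 : ∀ W, 0 ≤ c W) (hd0 : ∀ W, 0 ≤ d W) (hd'0 : ∀ W, 0 ≤ d' W)
    (hdc : ∀ W, d W ≤ c W) (hd'c : ∀ W, d' W ≤ c W) (hd'd : ∀ W, d' W ≤ d W)
    (hcc : ∀ s t, c s * c t ≤ c (s ∩ t) * c (s ∪ t))
    (hdd : ∀ s t, d s * d t ≤ d (s ∩ t) * d (s ∪ t))
    (hd'd' : ∀ s t, d' s * d' t ≤ d' (s ∩ t) * d' (s ∪ t))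
    (hcd : ∀ s t, c s * d t ≤ c (s ∩ t) * d (s ∪ t))
    (hcd' : ∀ s t, c s * d' t ≤ c (s ∩ t) * d' (s ∪ t))
    (hdd' : ∀ s t, d s * d' t ≤ d (s ∩ t) * d' (s ∪ t))
    (hratio : ∀ s t, s ⊆ t → d s * c t ≤ c s * d t)
    (hratio' : ∀ s t, s ⊆ t → d' s * c t ≤ c s * d' t)
    (x y : Finset V → R) (hx : ∀ W, x W = if m ∈ W then 1 else 0)
    (hy : ∀ W, y W = if j ∈ W then 1 else 0)
    (hpos0 : 0 < ∑ W ∈ U.powerset, ν W * chainMix {m} ent' 0 c d W)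
    (hpos1 : 0 < ∑ W ∈ U.powerset, ν W * chainMix {m} ent' 1 c d W)
    (hmI : 0 < ∑ W ∈ U.powerset.filter (fun W => ¬ ∃ r ∈ ({m} : Finset V) ∪ ent', r ∈ W), ν W * c W) :
    0 ≤ (∑ W ∈ U.powerset, ν W * chainMix {m} ent' ρ c d W) ^ 2 *
          (∑ W ∈ U.powerset, ν W * chainMix {m} ent' ρ c d' W * (x W * y W))
        - (∑ W ∈ U.powerset, ν W * chainMix {m} ent' ρ c d W) *
          (∑ W ∈ U.powerset, ν W * chainMix {m} ent' ρ c d W * x W) *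
          (∑ W ∈ U.powerset, ν W * chainMix {m} ent' ρ c d' W * y W)
        - (∑ W ∈ U.powerset, ν W * chainMix {m} ent' ρ c d W) *
          (∑ W ∈ U.powerset, ν W * chainMix {m} ent' ρ c d W * y W) *
          (∑ W ∈ U.powerset, ν W * chainMix {m} ent' ρ c d' W * x W)
        + (∑ W ∈ U.powerset, ν W * chainMix {m} ent' ρ c d W * x W) *
          (∑ W ∈ U.powerset, ν W * chainMix {m} ent' ρ c d W * y W) *
          (∑ W ∈ U.powerset, ν W * chainMix {m} ent' ρ c d' W) :=
  chain_functional_nonneg_of_XA' U {m} ent' ν c d d' ρ hρ0 hρ1 hν0 hν hc0 hd0 hd'0 hdc hd'c hd'd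
    hcc hdd hd'd' hcd hcd' hdd' hratio hratio' x y (marker_nonneg m x hx) (marker_nonneg j y hy)
    (marker_mono m x hx) (marker_mono j y hy) hpos0 hpos1 hmI
    (chain_XA'_six_general_gate U m j ent' hj ν c d d' hν0 hν hc0 hd0 hd'0 hdc hd'd hcc hdd hd'd' hcd hdd' x y hx hy)

end GeneralGate

end Summit.Ventures.PercRepro2.Coin
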